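import Summits.BirchSwinnertonDyer.Rank1Residual.AdditivePotMult.PotMultGreenbergKummerIdentification
import Summits.BirchSwinnertonDyer.Rank1Residual.AdditivePotMult.RamifiedOrdinaryLineMatching
import HarnessLib

/-!
# (M)–(M) congruent pairs: ramified ordinary lines WITH R-D that MATCH under every congruence — the
# complete local input package of a GV/EPW transfer with explicit `hRD` binders (cell `b2b-bsdres`,
# team n1011, seat p07 (gen 5); row T-RD-M sequel; `PotMultGreenbergKummerIdentification` +
# `RamifiedOrdinaryLineMatching` §1)

HONEST FRAMING (cell `b2b-bsdres`, run/shared/lean/b2b/bsd-rank1-residual/, verbatim in every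
file): the goal of the cell is to DELETE the COMBINATION-SHAPED residual classes of the
Birch–Swinnerton-Dyer formula for ALL analytic-rank `≤ 1` elliptic curves over `ℚ` — "full BSD
formula for every rank `≤ 1` curve in class `C`" assembled STRICTLY from published theorems — so
that the rank-`≤ 1` remainder becomes exactly the CONSTRUCTION-SHAPED classes, which are TYPED
(missing-input `Prop`s), NOT attempted. This is not "finishing BSD". Team n1011 (N10/N11, (M) rows):
research route; labels and marks UNCHANGED; nothing booked. Theorems only; NO definition; NO
Literature fact; the ONLY named facts are the published Tate uniformisation A40/A41 (`hT40`/`hT41`).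
Debt 0.

## What

cc-typer-2's GV-sourced transfer record (p264989,
`GreenbergVatsal2000.muLambdaAlg_transfer_of_torsionIso_potOrd_of_not_dvd_torsionOrder`) takes, per
pair, ramified ordinary lines `L₁`, `L₂`, the R-D binders `hRDᵢ : Lᵢ.greenbergKer κ.kerSubgroup =
Wᵢ.localKerOver p κ.kerSubgroup ℚ_v`, and a `Γ_ℚ`-equivariant `E₁[p] ≃ E₂[p]` RESPECTING the lines.
For two potentially multiplicative rows at the same odd `p` this file supplies ALL of it from a PLAIN
congruence: `exists_lines_matching_kummer_of_mult_twists` (twist level) and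
`PotMult.exists_lines_matching_kummer` (class level) — `∃ L L₁`, both `IsRamifiedOrdinaryLine`, both
with `greenbergKer (ker κ) = localKerOver` AND `strictKer (ker κ) = localKerOver` (the lines of
`PotMultGreenbergKummerIdentification`, mod A40/A41), and `∀ e` equivariant, `P ∈ L ↔ e P ∈ L₁`
(the shape clauses of those lines fed to `RamifiedOrdinaryLineMatching.inclusion_mem_iff_of_shape` at
an inertia element `σ₁` with `χ_p(σ₁) = 2`, exactly as in `exists_lines_matching_of_mult_twists`).
So on an (M)–(M) pair the residual per-pair inputs of that record are: `TorsionIso`, `Σ₀`, and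
`p ∤ #Eᵢ(ℚ)_tors` — nothing local at `p`.

What is NOT claimed: uniqueness of the lines; mixed (G-ord) × (M) pairs with R-D on the (G-ord) side
(that side's R-D is n1011-p05's `greenbergKer_twistMap_geomTransport_le_localKerOver`, conditional on
the typed Greenberg Prop. 2.4, one inclusion); `p = 2`. Nothing booked.

References: R. Greenberg, LNM 1716 (1999) §2 pp. 69–76; R. Greenberg, V. Vatsal, Invent. Math. 142
(2000) §2 pp. 14–16, 26; M. Emerton, R. Pollack, T. Weston, Invent. Math. 163 (2006) pp. 2–3, §3.1;
J. H. Silverman, *ATAEC* V.5.3–5.4, *AEC* X.5 Cor. 5.4.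
-/

noncomputable section

open scoped Classical NumberField AddSubgroup

namespace Summit.BirchSwinnertonDyer.Rank1Residual.AdditivePotMult

open NumberField IsDedekindDomain Field WeierstrassCurve
  Literature.NumberTheory.EllipticCurves
  Literature.NumberTheory.EllipticCurves.GreenbergSelmer
  Literature.NumberTheory.EllipticCurves.EmertonPollackWeston2006
  Literature.NumberTheory.GaloisRepresentations
  Literature.NumberTheory.EllipticCurves.Rank1Residual
  Summit.BirchSwinnertonDyer.Rank1Residual.X2
  Summit.BirchSwinnertonDyer.Rank1Residual.X2.GreenbergVatsalTateDatumTorsion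
  Summit.BirchSwinnertonDyer.Rank1Residual.GaloisImage.RamifiedOrdinaryLineTwist

namespace PotMultGreenbergKummer

/-! ### §1 Twist level: two ramified `c`-twists of multiplicative curves -/

section Pair

variable (V V₁ : WeierstrassCurve ℚ) [V.IsGloballyMinimal] [V.IsElliptic] [V₁.IsGloballyMinimal]
  [V₁.IsElliptic] (K : Type) [Field K] [NumberField K] (h2 : Module.finrank ℚ K = 2) {θ : K} {c : ℚ}
  (hθ : θ ∉ Set.range (algebraMap ℚ K)) (hc : θ ^ 2 = algebraMap ℚ K c) (p : ℕ) [hp : Fact p.Prime]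
  {W W₁ : WeierstrassCurve ℚ} {C C₁ : VariableChange ℚ} (hC : C • V.quadraticTwist c = W)
  (hC₁ : C₁ • V₁.quadraticTwist c = W₁)

include h2 hθ hc hC hC₁ in
/-- **Two ramified `c`-twists of multiplicative curves at the same odd `p`: ramified ordinary lines
WITH R-D over `ℚ_∞` that MATCH under every `Γ_ℚ`-equivariant `W[p] ≃ W₁[p]`** (mod A40/A41): the
lines of `exists_line_kummer_of_mult_twist` (Kummer = Greenberg = strict at `ker κ`), matched through
their inertia shapes at an element `σ₁ ∈ I_p` with `χ_p(σ₁) = 2`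
(`RamifiedOrdinaryLineMatching.inclusion_mem_iff_of_shape`).
[cite: GreenbergLNM1716, §2 pp. 74–76] [cite: EmertonPollackWeston2006, pp. 2–3 and §3.1 (eq:ordes) (arXiv:math/0404484 p. 17)]
[cite: SilvermanATAEC1994, Ch. V Thm. 5.3, Cor. 5.4] -/
theorem exists_lines_matching_kummer_of_mult_twists
    (hT40 : Silverman1994_thmV53_tateUniformisation.{0})
    (hT41 : Silverman1994_thmV53_corV54_tateUniformisation.{0}) (hp2 : p ≠ 2)
    (hmult : V.HasMultiplicativeReductionAtPrime p) (hmult₁ : V₁.HasMultiplicativeReductionAtPrime p)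
    (κ : ZpExtension ℚ p) (hκ : κ.IsCyclotomic)
    {v : HeightOneSpectrum (𝓞 ℚ)} (hv : ((p : ℕ) : 𝓞 ℚ) ∈ v.asIdeal)
    (hval : v.valuation ℚ c = WithZero.exp (-1 : ℤ)) :
    ∃ (L : LocalDatum ℚ (W.geomPrimaryTorsion p) v) (L₁ : LocalDatum ℚ (W₁.geomPrimaryTorsion p) v),
      IsRamifiedOrdinaryLine W p L ∧ IsRamifiedOrdinaryLine W₁ p L₁ ∧
      L.greenbergKer κ.kerSubgroup = W.localKerOver p κ.kerSubgroup (v.adicCompletion ℚ) ∧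
      L.strictKer κ.kerSubgroup = W.localKerOver p κ.kerSubgroup (v.adicCompletion ℚ) ∧
      L₁.greenbergKer κ.kerSubgroup = W₁.localKerOver p κ.kerSubgroup (v.adicCompletion ℚ) ∧
      L₁.strictKer κ.kerSubgroup = W₁.localKerOver p κ.kerSubgroup (v.adicCompletion ℚ) ∧
      ∀ e : geomTorsion W (p : ℤ) ≃+ geomTorsion W₁ (p : ℤ),
        (∀ (σ : absoluteGaloisGroup ℚ) (P : geomTorsion W (p : ℤ)), e (σ • P) = σ • e P) →
        ∀ P : geomTorsion W (p : ℤ),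
          AddSubgroup.inclusion (geomTorsion_le_geomPrimaryTorsion W p) P ∈ L.plus ↔
            AddSubgroup.inclusion (geomTorsion_le_geomPrimaryTorsion W₁ p) (e P) ∈ L₁.plus := by
  obtain ⟨L, hL, hqL, hlL, -, -, -, -, hgL, hsL⟩ := exists_line_kummer_of_mult_twist V K h2 hθ hc p hC
    hT40 hT41 hp2 hmult κ hκ hv hval
  obtain ⟨L₁, hL₁, hqL₁, hlL₁, -, -, -, -, hgL₁, hsL₁⟩ := exists_line_kummer_of_mult_twist V₁ K h2 hθ
    hc p hC₁ hT40 hT41 hp2 hmult₁ κ hκ hv hval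
  obtain ⟨σ₁, hσ₁, hχ⟩ := exists_mem_absInertia_cyclotomicCharacter_eq_natCast p hv (N := 2)
    (fun h ↦ hp2 ((Nat.prime_dvd_prime_iff_eq hp.out Nat.prime_two).mp h))
  refine ⟨L, L₁, hL, hL₁, hgL, hsL, hgL₁, hsL₁, fun e he P ↦
    RamifiedOrdinaryLineMatching.inclusion_mem_iff_of_shape L L₁ e he
      (g := absGaloisRestrict ℚ (v.adicCompletion ℚ) σ₁) ?_ P⟩
  by_cases hg : absGaloisRestrict ℚ (v.adicCompletion ℚ) σ₁ ∈ galRange (K := ℚ) K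
  · exact Or.inl ⟨fun m hm _ ↦ ((hlL σ₁ hσ₁ 2 hχ m hm).1 hg), (hqL σ₁ hσ₁).1 hg,
      fun m hm _ ↦ ((hlL₁ σ₁ hσ₁ 2 hχ m hm).1 hg), (hqL₁ σ₁ hσ₁).1 hg⟩
  · exact Or.inr ⟨fun m hm _ ↦ ((hlL σ₁ hσ₁ 2 hχ m hm).2 hg), (hqL σ₁ hσ₁).2 hg,
      fun m hm _ ↦ ((hlL₁ σ₁ hσ₁ 2 hχ m hm).2 hg), (hqL₁ σ₁ hσ₁).2 hg⟩

end Pair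

end PotMultGreenbergKummer

/-! ### §2 Class level: any two potentially multiplicative rows at the same odd `p` -/

section Classes

variable {W W₁ : WeierstrassCurve ℚ} [W.IsElliptic] [W₁.IsElliptic] {p : ℕ} [hp : Fact p.Prime]

/-- **(M)–(M) pairs, EVERY odd `p` (`p = 3` included), mod A40/A41: lines with R-D, matched by ANY
congruence.** For `E = W`, `E₁ = W₁` both additive potentially multiplicative at `p`, the cyclotomic
`κ` and `v ∋ p`: `∃ L L₁`, both ramified ordinary lines, both with
`greenbergKer (ker κ) = localKerOver = strictKer (ker κ)` over `ℚ_∞`, and every `Γ_ℚ`-equivariant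
`E[p] ≃+ E₁[p]` satisfies `P ∈ L ↔ e P ∈ L₁` — the full local input of a GV/EPW transfer with R-D
binders (cc-typer-2 p264989) on such a pair, from `TorsionIso` alone. Nothing booked.
[cite: GreenbergLNM1716, §2 pp. 74–76] [cite: GreenbergVatsal2000, §2 pp. 14–16 and p. 26]
[cite: SilvermanATAEC1994, Ch. V Thm. 5.3, Cor. 5.4] -/
theorem PotMult.exists_lines_matching_kummer (hT40 : Silverman1994_thmV53_tateUniformisation.{0})
    (hT41 : Silverman1994_thmV53_corV54_tateUniformisation.{0}) (hp2 : p ≠ 2)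
    (hpm : PotMult W p) (hpm₁ : PotMult W₁ p) (κ : ZpExtension ℚ p) (hκ : κ.IsCyclotomic)
    {v : HeightOneSpectrum (𝓞 ℚ)} (hv : ((p : ℕ) : 𝓞 ℚ) ∈ v.asIdeal) :
    ∃ (L : LocalDatum ℚ (W.geomPrimaryTorsion p) v) (L₁ : LocalDatum ℚ (W₁.geomPrimaryTorsion p) v),
      IsRamifiedOrdinaryLine W p L ∧ IsRamifiedOrdinaryLine W₁ p L₁ ∧
      L.greenbergKer κ.kerSubgroup = W.localKerOver p κ.kerSubgroup (v.adicCompletion ℚ) ∧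
      L.strictKer κ.kerSubgroup = W.localKerOver p κ.kerSubgroup (v.adicCompletion ℚ) ∧
      L₁.greenbergKer κ.kerSubgroup = W₁.localKerOver p κ.kerSubgroup (v.adicCompletion ℚ) ∧
      L₁.strictKer κ.kerSubgroup = W₁.localKerOver p κ.kerSubgroup (v.adicCompletion ℚ) ∧
      ∀ e : geomTorsion W (p : ℤ) ≃+ geomTorsion W₁ (p : ℤ),
        (∀ (σ : absoluteGaloisGroup ℚ) (P : geomTorsion W (p : ℤ)), e (σ • P) = σ • e P) →
        ∀ P : geomTorsion W (p : ℤ),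
          AddSubgroup.inclusion (geomTorsion_le_geomPrimaryTorsion W p) P ∈ L.plus ↔
            AddSubgroup.inclusion (geomTorsion_le_geomPrimaryTorsion W₁ p) (e P) ∈ L₁.plus := by
  obtain ⟨V, _, _, C, hV, hC⟩ := hpm.exists_mult_pStar_twist_model hp2
  obtain ⟨V₁, _, _, C₁, hV₁, hC₁⟩ := hpm₁.exists_mult_pStar_twist_model hp2
  obtain ⟨K, _, _, hK2, θ, hθ, hθ2⟩ := RamifiedOrdinaryLinePotMult.exists_numberField_sq_eq_pStar hp2
  exact PotMultGreenbergKummer.exists_lines_matching_kummer_of_mult_twists V V₁ K hK2 hθ hθ2 p hC hC₁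
    hT40 hT41 hp2 hV hV₁ κ hκ hv (RamifiedOrdinaryLinePotMult.valuation_pStar p v hv)

/-- **X4(M)–X4(M) pairs** (Route G's (M)–(M) congruent pairs): the same, class binders `ClassX4M`.
[cite: GreenbergLNM1716, §2 pp. 74–76] [cite: SilvermanATAEC1994, Ch. V Thm. 5.3, Cor. 5.4] -/
theorem ClassX4M.exists_lines_matching_kummer (hT40 : Silverman1994_thmV53_tateUniformisation.{0})
    (hT41 : Silverman1994_thmV53_corV54_tateUniformisation.{0}) (hX : ClassX4M W p)
    (hX₁ : ClassX4M W₁ p) (κ : ZpExtension ℚ p) (hκ : κ.IsCyclotomic)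
    {v : HeightOneSpectrum (𝓞 ℚ)} (hv : ((p : ℕ) : 𝓞 ℚ) ∈ v.asIdeal) :
    ∃ (L : LocalDatum ℚ (W.geomPrimaryTorsion p) v) (L₁ : LocalDatum ℚ (W₁.geomPrimaryTorsion p) v),
      IsRamifiedOrdinaryLine W p L ∧ IsRamifiedOrdinaryLine W₁ p L₁ ∧
      L.greenbergKer κ.kerSubgroup = W.localKerOver p κ.kerSubgroup (v.adicCompletion ℚ) ∧
      L.strictKer κ.kerSubgroup = W.localKerOver p κ.kerSubgroup (v.adicCompletion ℚ) ∧
      L₁.greenbergKer κ.kerSubgroup = W₁.localKerOver p κ.kerSubgroup (v.adicCompletion ℚ) ∧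
      L₁.strictKer κ.kerSubgroup = W₁.localKerOver p κ.kerSubgroup (v.adicCompletion ℚ) ∧
      ∀ e : geomTorsion W (p : ℤ) ≃+ geomTorsion W₁ (p : ℤ),
        (∀ (σ : absoluteGaloisGroup ℚ) (P : geomTorsion W (p : ℤ)), e (σ • P) = σ • e P) →
        ∀ P : geomTorsion W (p : ℤ),
          AddSubgroup.inclusion (geomTorsion_le_geomPrimaryTorsion W p) P ∈ L.plus ↔
            AddSubgroup.inclusion (geomTorsion_le_geomPrimaryTorsion W₁ p) (e P) ∈ L₁.plus :=
  (ClassX4M.potMult W p hX).exists_lines_matching_kummer hT40 hT41 hX.p_ne_two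
    (ClassX4M.potMult W₁ p hX₁) κ hκ hv

end Classes

end Summit.BirchSwinnertonDyer.Rank1Residual.AdditivePotMult

end
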